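import Summits.QuantumFields.BalabanUV.Beta.CompositeOneShotJetData
import Summits.QuantumFields.BalabanUV.Beta.RelInvCompositeSocket
import Summits.QuantumFields.BalabanUV.Beta.RelInvUnique
import Summits.QuantumFields.BalabanUV.Beta.RelInvNullShift
import Summits.QuantumFields.BalabanUV.Beta.FP.StepKernelWardDataRecord
import Summits.QuantumFields.BalabanUV.Beta.FP.CompositeOneShotJetDataSym
import Summits.QuantumFields.BalabanUV.Beta.NVertexSectors

/-!
# `BalabanUV.Beta.FP.TowerKernelLawNamedSym` — road «FP», OPTION L's END SIGNATURE ON TREE NAMES (S-L3a of FILING PLAN FP-L; FILED under row-D1 RULING R-D1-g93-1 [AN2-G93-R1] l.69911 — L commissioned at (L-disp) per director-ym g22's ONE LINE — co-signed by the road [D1P3-G71-ONLINE] l.69914) = XREAD-L v1.4 2e6665b5 (chair-reproduced g67∕g68) with §0's chart `ANs`∕`spr_ANs` taken from S-L1 `FP.CompositeOneShotJetDataSym` (same definiens), nothing else changed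

CONTENT (verbatim from XREAD-L v1.4): §0 `ANs_eq`, `relInv_ANs`; §1 `VNsOf`; §2 `d1Tel_sym_of_hlawL`; §3 `d1Tel_sym_record_of_hlawL`∕`_of_hessKer_law`∕`_ctr_of_hlawL`; §4 `eq_ANs_of_relInv_rows`,
`AN_eq_ANs_of_relInv_rows`; §5 `relInv_ANs_of_null`, `eq_ANs_of_null_of_relInv`; §6 `dressCorrAt`, `pullJs`, `TOf_pullJs`, `JcSym`, `hN_JcSym`, `d1Tel_sym_record_JcSym_of_hlawL`;
§7 `d1Tel_sym_record_JcSym_of_hlawL_pinned` — L's END BY NAME = `hlawL` + the corrector letters + `hadj` + the four pins, nothing else. Under ruling (b) this is S-L3a of the joint filing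
plan; S-L3b `FP.StepRecursionSymEnd` feeds every displayed letter from the row's F-L1∕F-L5 and S-L1's jets. [our object — bookkeeping] defs `VNsOf dressCorrAt pullJs JcSym` (review-queued
at filing) + [folklore] lemmas; no `def … : Prop`, nothing cited, 0 sorry; `hlawL` and every corrector letter are displayed HYPOTHESES; nothing of Bałaban's asserted, valued or discharged
(ABSOLUTE RULE); 0 estimates; 0∕4 row-D1 binders; the literal of record UNTOUCHED; NOT (C1), NOT (T-ID), NOT SDF, NOT D1, NEVER «G-an2-4 closed», NOT BetaPertH, NOT continuum, NOT Clay.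
DISPLAY RULE FOR `hlawL` (RULING R-D1-g93-1 (R4) = director-ym g22's [DIRYM-G22-INBOX-1], adopted verbatim; co-signed by the road [D1P3-G71-ONLINE]): wherever `hlawL` is displayed below it is ONE binder carrying (i) «OPEN by name — the [K-step] law itself is the crux»; (ii) its by-value status OF RECORD: Engine C float64 at ONE lattice (2,3): S2 factored 1.46e−12, D₁⁺ 1.86e−12 — `prestab/tel2/span/SPAN-SYM2.addendum4.md` 56c550e9, RULING SYM2-10 (informational, zero weight on any binder); (iii) the cite — PRINTED CONTEXT, orientation only, nothing of it quoted as a statement (ABSOLUTE RULE; same locator as `HessianTelescopingKKT`): T. Bałaban, *Renormalization group approach to lattice gauge field theories. I*, Commun. Math. Phys. **109** (1987) 249–301 [B12], p. 264, (1.20)–(1.22) (`Π_{j+1}`, `β_{j+1}(g_j) = Σ_x Π_{j+1,μν}(g_j,x) x_μ x_ν`; the cell's one-step reading of it is `HessianTelescopingKKT.StepRecursion`, whose row on the L-chart `hlawL` is).  The END's kernel-printed signature = data + 4 pins + ONE law, nothing else (S-L3b `FP.StepRecursionSymEnd.d1Tel_L_of_hlawL'`; chair XCHK-LEND∕SL3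∕SL3b).

HONEST DEPENDENCY (page 1, mandatory): continuum YM on T⁴ ⇐ BetaPertH ∧ nine spine estimates (0/9 proved); BetaPertH ⇐ (D1) ∧ (D4) ∧ CAP+tail;
G-an2-4 gates asym, D1 and NE2/3/4.  HONEST FRAMING (cell contract, verbatim): «discharging `BetaPertH` makes Bałaban's UV stability UNCONDITIONAL —
a real constructive-QFT result; it is NOT the continuum limit and NOT the Clay problem.»  ABSOLUTE RULE (cell charter, verbatim): «No internally-minted
statement may enter as a cited fact. Every hypothesis is either kernel-proved in this package or a verbatim quotation of a PUBLISHED theorem with page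
reference. The manuscript(s) under audit are NOT citable for their own disputed steps — they are the thing under adjudication; programme-internal
(2001/route/tribunal) claims are never citable.»  Road «FP» OWNER, b2b-balaban-beta-d1-p3 gen 70 (typed; staged v1.1 e90bdf4e, chair XCHK-SL3∕SL3b HOLD 0) ∕ gen 71 (filed), 2026-08-31 (from gen 67∕68's xread).  No existing file touched.
-/

noncomputable section
namespace Summit.QuantumFields.BalabanUV.Beta.FP.TowerKernelLawNamedSym

open Summit.QuantumFields.BalabanUV.Beta.FP.CompositeOneShotJetDataSym (ANs spr_ANs)
open Summit.QuantumFields.BalabanUV.Beta.NVertexSectors (decays_AN)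

open Literature.MathematicalPhysics.QuantumFieldTheory
open Literature.MathematicalPhysics.QuantumFieldTheory.Balaban1983to89
open Literature.MathematicalPhysics.QuantumFieldTheory.Balaban1983to89.Beta
open DressedMomentNormalisation (EKer dressedEntry)
open ExpKernelCalculus (MKer Decays comp hessKer)
open AffineAveraging (Site box toSite)
open OneStepResolventKernel (Fib KInv JetData)
open OneStepKernelFamily (TshotOf TbalOf D1Tel vertexOfK)
open HessianTelescopingKKT (wStep)
open HessKerSchurResolvent (idK)
open Summit.QuantumFields.BalabanUV.Beta.TameKernelCalculus
open Summit.QuantumFields.BalabanUV.Beta.ChartConjugationRelative (RelInv spr_comp)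
open Summit.QuantumFields.BalabanUV.Beta.AxialDressingRooted (one_le_of_neZero coDressKBmAt spr_coDressKBmAt axEc spr_axEc)
open Summit.QuantumFields.BalabanUV.Beta.BorderedHessian (bhK spr_KInv)
open Summit.QuantumFields.BalabanUV.Beta.RelInvCompositeSocket (relInv_composite_of_corrector)
open Summit.QuantumFields.BalabanUV.Beta.SymSecondOrderTablesAn1 (symTablesAn1S2)
open Summit.QuantumFields.BalabanUV.Beta.CombChartStepJets (GcombSh JsB12CombSh0)
open Summit.QuantumFields.BalabanUV.Beta.CombChartJointEnd (JsB12CombShSym TbalOf_JsB12CombShSym)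
open Summit.QuantumFields.BalabanUV.Beta.CombOneShotJets (JcOf)
open Summit.QuantumFields.BalabanUV.Beta.CompositeOneShotJetData (Roots Pins JNat WN AN AN_eq Roots.ctr)
open Summit.QuantumFields.BalabanUV.Beta.CompositeOneShotJets (decays_compChart)
open Summit.QuantumFields.BalabanUV.Beta.RelInvUnique (relInv_unique)
open Summit.QuantumFields.BalabanUV.Beta.RelInvNullShift (relInv_add_of_sandwich_null spr_add)
open Summit.QuantumFields.BalabanUV.Beta.BorderedHessian (spr_bhK)
open Summit.QuantumFields.BalabanUV.Beta.FP.StepRecursionFeed (d1Tel_of_kernel_laws_wStep d1Tel_anchored_of_kernel_laws_wStep)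
open Summit.QuantumFields.BalabanUV.Beta.FP.StepKernelWardDataRecord (stepT0_JsB12CombShSym_an1S2_pinned stepT1_JsB12CombShSym_an1S2_pinned)
open ExpKernelCalculus (VertexFamily₂)
open OneStepResolventKernel (LocStencil TOf vertexOf decays_KInv biLoc_mono)
open OneStepKernelFamily (vertexOfK_KInv)
open Summit.QuantumFields.BalabanUV.Beta.AxialDressingRooted (dressBmAt hessKer_dressBmAt)
open Summit.QuantumFields.BalabanUV.Beta.CompositeCorrectorDress (sandS sandW cSand locStencil_sandS vertexFamily₂_sandW hessKer_sand_of_adj)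

/-! ## §0 The (0.4)-corrected composite chart over a DISPLAYED corrector family, and its relative-inverse law by the owner's generic socket -/

section Chart

variable {Lc : ℕ} [NeZero Lc] (R : Roots Lc) (Ψs : ℕ → MKer (3 + 1) (Fib 3))

/-- [folklore] S-L1's chart `ANs R Ψs j` unfolded (`rfl`): the composite one-shot sandwich `Ψs (j+1) ∘ coDressKBmAt (toSite (R.s (j+1))) (Lc^(j+1)) KInv ∘ (Ψs (j+1))ᵀ`. -/
theorem ANs_eq (j : ℕ) :
    ANs R Ψs j = comp (comp (Ψs (j + 1)) (coDressKBmAt (toSite (R.s (j + 1))) (Lc ^ (j + 1)) (KInv (N := Lc ^ (j + 1)) (d := 3)))) (trK (Ψs (j + 1))) := rfl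

/-- [folklore] **THE CHART IS THE ROWS' RELATIVE INVERSE** (an2 E-AN2-89-2), by the owner's GENERIC corrector socket `RelInvCompositeSocket.relInv_composite_of_corrector`: for a corrector
pair `(Ψs, Φs)` that is spread, mutually inverse and compatible with the coarse axial slice at the big root, `RelInv (ANs R Ψs j) ((Φs (j+1))ᵀ ∘ bhK (Lc^(j+1)) ∘ Φs (j+1)) (axEc (toSite (R.s (j+1)))
(Lc^(j+1)))`.  The four letters are DISPLAYED; the (0.4) content — «the congruence-bordered Hessian's slot rows ARE the (0.4) composite rows» — is K-U3d-sym (absent) and is NOT asserted. -/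
theorem relInv_ANs (Φs : ℕ → MKer (3 + 1) (Fib 3)) (j : ℕ) (hΨ : Spr (Ψs (j + 1))) (hΦ : Spr (Φs (j + 1)))
    (hΨΦ : comp (Ψs (j + 1)) (Φs (j + 1)) = idK) (hΦΨ : comp (Φs (j + 1)) (Ψs (j + 1)) = idK)
    (hEΨ : comp (comp (axEc (toSite (R.s (j + 1))) (Lc ^ (j + 1))) (Ψs (j + 1))) (axEc (toSite (R.s (j + 1))) (Lc ^ (j + 1)))
      = comp (Ψs (j + 1)) (axEc (toSite (R.s (j + 1))) (Lc ^ (j + 1))))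
    (hEΦ : comp (comp (axEc (toSite (R.s (j + 1))) (Lc ^ (j + 1))) (Φs (j + 1))) (axEc (toSite (R.s (j + 1))) (Lc ^ (j + 1)))
      = comp (Φs (j + 1)) (axEc (toSite (R.s (j + 1))) (Lc ^ (j + 1)))) :
    RelInv (ANs R Ψs j) (comp (comp (trK (Φs (j + 1))) (bhK (Lc ^ (j + 1)))) (Φs (j + 1))) (axEc (toSite (R.s (j + 1))) (Lc ^ (j + 1))) :=
  relInv_composite_of_corrector (N := Lc ^ (j + 1)) (d := 3) (R.hs (j + 1)) hΨ hΦ hΨΦ hΦΨ hEΨ hEΦ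

end Chart

/-! ## §1 The N-system's families read through the L-chart -/

section Families

variable {Lc : ℕ} [NeZero Lc]

/-- [our object — bookkeeping] **THE N-SYSTEM's FIRST-ORDER FAMILY UNDER L**: the chain-rule vertex of the raw composite jets `JN (j+1)` through the SYM chart's OWN ℋ-column. -/
def VNsOf (R : Roots Lc) (Ψs : ℕ → MKer (3 + 1) (Fib 3)) (JN : ∀ m : ℕ, JetData 3 (Lc ^ m)) (j : ℕ) :
    Fin (3 + 1) → Site (3 + 1) → MKer (3 + 1) (Fib 3) :=
  vertexOfK (ANs R Ψs j) (Lc ^ (j + 1)) (JN (j + 1)).S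

/-- [folklore] `VNsOf` unfolded (`rfl`). -/
theorem VNsOf_eq (R : Roots Lc) (Ψs : ℕ → MKer (3 + 1) (Fib 3)) (JN : ∀ m : ℕ, JetData 3 (Lc ^ m)) (j : ℕ) :
    VNsOf R Ψs JN j = vertexOfK (ANs R Ψs j) (Lc ^ (j + 1)) (JN (j + 1)).S := rfl

end Families

/-! ## §2 THE L-END, generic literal: the law on the (0.4) chart as ONE row + the composite identification `hN` displayed -/

section EndGeneric

variable {Lc : ℕ} [NeZero Lc] (R : Roots Lc) (Ψs : ℕ → MKer (3 + 1) (Fib 3)) (JN : ∀ m : ℕ, JetData 3 (Lc ^ m))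
  (Js : ℕ → JetData 3 Lc) (Jc : ∀ m : ℕ, JetData 3 (Lc ^ m))

/-- [folklore] **`TowerKernelLawNamedSym` — THE L-END, GENERIC LITERAL AND COMPOSITE.**  For any `R Ψs JN Js Jc`: IF (hlawL) for every storey `j ≥ 1` the one-loop kernel on the L-chart with
the raw composite jets equals the `Lc⁸·dE(wStep Lc j)`-transport of `TshotOf Jc j` PLUS `TbalOf Js j` (F and G NAMED), (hN) that kernel IS `TshotOf Jc (j+1)` (the (0.4) composite dressing
functor's content — DISPLAYED), (hbase) `TshotOf Jc 1 = TbalOf Js 0`, and (hT0 hT1) the literal's moment letters, THEN `D1Tel Lc Js Jc`.  #28 §3 with `hF hG := rfl`.  `hlawL` DISPLAY RULE (R-D1-g93-1 (R4)): (i) OPEN by name — the [K-step] law itself is the crux; (ii) ✓ by value OF RECORD at ONE lattice (2,3), float64 (S2 factored 1.46e−12, D₁⁺ 1.86e−12; `SPAN-SYM2.addendum4.md` 56c550e9, RULING SYM2-10; informational, zero weight); (iii) cite [B12] CMP 109 (1987) p. 264 (1.20)–(1.22), printed context only (ABSOLUTE RULE). -/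
theorem d1Tel_sym_of_hlawL
    (hN : ∀ j : ℕ, 1 ≤ j → ∀ (a b : Fin 4) (z : Fin 4 → ℤ), hessKer (ANs R Ψs j) (VNsOf R Ψs JN j) (JN (j + 1)).W a b z = TshotOf Lc Jc (j + 1) a b z)
    (hlawL : ∀ j : ℕ, 1 ≤ j → ∀ (a b : Fin 4) (z : Fin 4 → ℤ),
      hessKer (ANs R Ψs j) (VNsOf R Ψs JN j) (JN (j + 1)).W a b z =
        (Lc : ℝ) ^ 8 * dressedEntry (wStep Lc j) (TshotOf Lc Jc j) ((Lc : ℤ) • z) a b + TbalOf Lc Js j a b z)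
    (hT0 : ∀ j (c e : Fin 4), HasSum (TbalOf Lc Js j c e) 0)
    (hT1 : ∀ j (c e ρ : Fin 4), HasSum (fun t : Fin 4 → ℤ => t ρ • TbalOf Lc Js j c e t) 0)
    (hbase : TshotOf Lc Jc 1 = TbalOf Lc Js 0) : D1Tel Lc Js Jc :=
  d1Tel_of_kernel_laws_wStep Js Jc (fun j => hessKer (ANs R Ψs j) (VNsOf R Ψs JN j) (JN (j + 1)).W)
    (fun j a b z => (Lc : ℝ) ^ 8 * dressedEntry (wStep Lc j) (TshotOf Lc Jc j) ((Lc : ℤ) • z) a b) (TbalOf Lc Js)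
    hlawL hN (fun _ _ _ _ _ => rfl) (fun _ _ _ _ _ => rfl) hT0 hT1 hbase

end EndGeneric

/-! ## §3 AT THE RECORD LITERAL (ROOT M‴'s `JsB12CombShSym` on `GcombSh`): the anchored END and the engine-currency split with `hG` DISCHARGED -/

section EndRecord

variable {Lc : ℕ} [NeZero Lc] (hLc : Odd Lc) (N : ℕ) (cΛ cB : ℝ) (R : Roots Lc) (Ψs : ℕ → MKer (3 + 1) (Fib 3))
  (JN : ∀ m : ℕ, JetData 3 (Lc ^ m)) (Jc : ∀ m : ℕ, JetData 3 (Lc ^ m))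

/-- [folklore] **THE L-END AT THE RECORD LITERAL, ANCHORED** — `Js := JsB12CombShSym hLc N (symTablesAn1S2 3 Lc cΛ) cΛ cB` (ROOT M‴'s, UNTOUCHED), `Jc 1 = JcOf … 1` (the record's anchor, by
`rfl` for `JcComp`∕`JcCompW`-shaped data — CORRECT under L since the literal is the record's): `D1Tel Lc Js Jc` ⟸ `hN ∧ hlawL ∧ hT0 ∧ hT1` (#28 §5 `d1Tel_anchored_of_kernel_laws_wStep`).  `hlawL` DISPLAY RULE (R-D1-g93-1 (R4)): (i) OPEN by name — the [K-step] law itself is the crux; (ii) ✓ by value OF RECORD at ONE lattice (2,3), float64 (S2 factored 1.46e−12, D₁⁺ 1.86e−12; `SPAN-SYM2.addendum4.md` 56c550e9, RULING SYM2-10; informational, zero weight); (iii) cite [B12] CMP 109 (1987) p. 264 (1.20)–(1.22), printed context only (ABSOLUTE RULE). -/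
theorem d1Tel_sym_record_of_hlawL (hJc1 : Jc 1 = JcOf hLc N (fun _ => cΛ) (fun _ => cB) 1)
    (hN : ∀ j : ℕ, 1 ≤ j → ∀ (a b : Fin 4) (z : Fin 4 → ℤ), hessKer (ANs R Ψs j) (VNsOf R Ψs JN j) (JN (j + 1)).W a b z = TshotOf Lc Jc (j + 1) a b z)
    (hlawL : ∀ j : ℕ, 1 ≤ j → ∀ (a b : Fin 4) (z : Fin 4 → ℤ),
      hessKer (ANs R Ψs j) (VNsOf R Ψs JN j) (JN (j + 1)).W a b z =
        (Lc : ℝ) ^ 8 * dressedEntry (wStep Lc j) (TshotOf Lc Jc j) ((Lc : ℤ) • z) a b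
          + TbalOf Lc (JsB12CombShSym hLc N (symTablesAn1S2 3 Lc cΛ) cΛ cB) j a b z)
    (hT0 : ∀ j (c e : Fin 4), HasSum (TbalOf Lc (JsB12CombShSym hLc N (symTablesAn1S2 3 Lc cΛ) cΛ cB) j c e) 0)
    (hT1 : ∀ j (c e ρ : Fin 4), HasSum (fun t : Fin 4 → ℤ => t ρ • TbalOf Lc (JsB12CombShSym hLc N (symTablesAn1S2 3 Lc cΛ) cΛ cB) j c e t) 0) :
    D1Tel Lc (JsB12CombShSym hLc N (symTablesAn1S2 3 Lc cΛ) cΛ cB) Jc :=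
  d1Tel_anchored_of_kernel_laws_wStep hLc N cΛ cB Jc hJc1 (fun j => hessKer (ANs R Ψs j) (VNsOf R Ψs JN j) (JN (j + 1)).W)
    (fun j a b z => (Lc : ℝ) ^ 8 * dressedEntry (wStep Lc j) (TshotOf Lc Jc j) ((Lc : ℤ) • z) a b)
    (TbalOf Lc (JsB12CombShSym hLc N (symTablesAn1S2 3 Lc cΛ) cΛ cB)) hlawL hN (fun _ _ _ _ _ => rfl) (fun _ _ _ _ _ => rfl) hT0 hT1

/-- [folklore] **THE SAME IN THE ENGINE's `hessKer` CURRENCY** — NamedC at the SYM rows concludes per storey `hessKer AN′ 𝒱N 𝒲N = hessKer AF 𝒱F 𝒲F + hessKer (GcombSh Lc (lev 0)) 𝒱G 𝒲G`;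
under L the N-system is READ on `ANs` and the G-system is PINNED to ROOT M‴'s UNDRESSED member j on `GcombSh Lc j` (`vertexOfK (GcombSh Lc j) Lc (JsB12CombSh0 … j).S`, `(JsB12CombSh0 … j).W`)
— `hG` DISCHARGED by an2's `TbalOf_JsB12CombShSym` (tree).  Displayed: `hlaw`, `hF`, `hN`, `hT0 hT1` — nothing else. -/
theorem d1Tel_sym_record_of_hessKer_law (hJc1 : Jc 1 = JcOf hLc N (fun _ => cΛ) (fun _ => cB) 1) (AF : ℕ → MKer (3 + 1) (Fib 3))
    (𝒱F : ℕ → Fin (3 + 1) → (Fin (3 + 1) → ℤ) → MKer (3 + 1) (Fib 3))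
    (𝒲F : ℕ → Fin (3 + 1) → (Fin (3 + 1) → ℤ) → Fin (3 + 1) → (Fin (3 + 1) → ℤ) → MKer (3 + 1) (Fib 3))
    (hN : ∀ j : ℕ, 1 ≤ j → ∀ (a b : Fin 4) (z : Fin 4 → ℤ), hessKer (ANs R Ψs j) (VNsOf R Ψs JN j) (JN (j + 1)).W a b z = TshotOf Lc Jc (j + 1) a b z)
    (hlaw : ∀ j : ℕ, 1 ≤ j → ∀ (a b : Fin 4) (z : Fin 4 → ℤ),
      hessKer (ANs R Ψs j) (VNsOf R Ψs JN j) (JN (j + 1)).W a b z =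
        hessKer (AF j) (𝒱F j) (𝒲F j) a b z
          + hessKer (GcombSh (d := 3) Lc j) (vertexOfK (GcombSh (d := 3) Lc j) Lc (JsB12CombSh0 hLc N (symTablesAn1S2 3 Lc cΛ) cΛ cB j).S)
              (JsB12CombSh0 hLc N (symTablesAn1S2 3 Lc cΛ) cΛ cB j).W a b z)
    (hF : ∀ j : ℕ, 1 ≤ j → ∀ (a b : Fin 4) (z : Fin 4 → ℤ),
      hessKer (AF j) (𝒱F j) (𝒲F j) a b z = (Lc : ℝ) ^ 8 * dressedEntry (wStep Lc j) (TshotOf Lc Jc j) ((Lc : ℤ) • z) a b)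
    (hT0 : ∀ j (c e : Fin 4), HasSum (TbalOf Lc (JsB12CombShSym hLc N (symTablesAn1S2 3 Lc cΛ) cΛ cB) j c e) 0)
    (hT1 : ∀ j (c e ρ : Fin 4), HasSum (fun t : Fin 4 → ℤ => t ρ • TbalOf Lc (JsB12CombShSym hLc N (symTablesAn1S2 3 Lc cΛ) cΛ cB) j c e t) 0) :
    D1Tel Lc (JsB12CombShSym hLc N (symTablesAn1S2 3 Lc cΛ) cΛ cB) Jc := by
  refine d1Tel_sym_record_of_hlawL hLc N cΛ cB R Ψs JN Jc hJc1 hN (fun j hj a b z => ?_) hT0 hT1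
  rw [hlaw j hj a b z, hF j hj a b z, TbalOf_JsB12CombShSym hLc N (symTablesAn1S2 3 Lc cΛ) cΛ cB j]

/-- [folklore] **THE RECORD INSTANCE** `R := Roots.ctr Lc`, `JN := JNat (Roots.ctr Lc) Pn` (F6d-2's raw composite jets of record; `(JN (j+1)).W = WN (Roots.ctr Lc) Pn j` by `rfl`), any `Ψs`. -/
theorem d1Tel_sym_record_ctr_of_hlawL (Pn : Pins) (hJc1 : Jc 1 = JcOf hLc N (fun _ => cΛ) (fun _ => cB) 1)
    (hN : ∀ j : ℕ, 1 ≤ j → ∀ (a b : Fin 4) (z : Fin 4 → ℤ),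
      hessKer (ANs (Roots.ctr Lc) Ψs j) (VNsOf (Roots.ctr Lc) Ψs (JNat (Roots.ctr Lc) Pn) j) (WN (Roots.ctr Lc) Pn j) a b z = TshotOf Lc Jc (j + 1) a b z)
    (hlawL : ∀ j : ℕ, 1 ≤ j → ∀ (a b : Fin 4) (z : Fin 4 → ℤ),
      hessKer (ANs (Roots.ctr Lc) Ψs j) (VNsOf (Roots.ctr Lc) Ψs (JNat (Roots.ctr Lc) Pn) j) (WN (Roots.ctr Lc) Pn j) a b z =
        (Lc : ℝ) ^ 8 * dressedEntry (wStep Lc j) (TshotOf Lc Jc j) ((Lc : ℤ) • z) a b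
          + TbalOf Lc (JsB12CombShSym hLc N (symTablesAn1S2 3 Lc cΛ) cΛ cB) j a b z)
    (hT0 : ∀ j (c e : Fin 4), HasSum (TbalOf Lc (JsB12CombShSym hLc N (symTablesAn1S2 3 Lc cΛ) cΛ cB) j c e) 0)
    (hT1 : ∀ j (c e ρ : Fin 4), HasSum (fun t : Fin 4 → ℤ => t ρ • TbalOf Lc (JsB12CombShSym hLc N (symTablesAn1S2 3 Lc cΛ) cΛ cB) j c e t) 0) :
    D1Tel Lc (JsB12CombShSym hLc N (symTablesAn1S2 3 Lc cΛ) cΛ cB) Jc :=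
  d1Tel_sym_record_of_hlawL hLc N cΛ cB (Roots.ctr Lc) Ψs (JNat (Roots.ctr Lc) Pn) Jc hJc1 hN hlawL hT0 hT1

end EndRecord

/-! ## §4 (v1.1, an2 W-4 (β)) K-U3d-sym's content as ONE displayed `RelInv` row against a (0.4)-bordered composite Hessian family, and the chart PINNED by it (`RelInvUnique`, PART 123) -/

section Rows

variable {Lc : ℕ} [NeZero Lc] (R : Roots Lc) (Ψs 𝕄s : ℕ → MKer (3 + 1) (Fib 3))

/-- [folklore] **THE L-CHART IS PINNED BY ONE `RelInv` ROW** (an2 W-4 (β); `RelInvUnique.relInv_unique`, PART 123 p777287).  Display K-U3d-sym's content as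
`hrowsS : RelInv (ANs R Ψs j) (𝕄s j) (axEc (toSite (R.s (j+1))) (Lc^(j+1)))` against a DISPLAYED family `𝕄s` (to be instantiated: the depth-(j+1) ff-Hessian bordered by the (0.4) COMPOSITE ROWS
`compRowsSym` — v10's `𝔔₀`; SYM2's `A₂^{sym}` is its exact torus inverse BY VALUE); THEN any spread kernel `A′` with the same row IS `ANs R Ψs j` — whatever corrector `Ψs` realises it.  So
Engine C's direct KKT solve MEASURES the displayed object with no corrector formula, and two (0.4) correctors give the same chart. -/
theorem eq_ANs_of_relInv_rows (j : ℕ) (hΨ : ∀ m, Spr (Ψs m)) (h𝕄 : Spr (𝕄s j)) {A' : MKer (3 + 1) (Fib 3)} (hA' : Spr A')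
    (hrowsS : RelInv (ANs R Ψs j) (𝕄s j) (axEc (toSite (R.s (j + 1))) (Lc ^ (j + 1))))
    (hrows' : RelInv A' (𝕄s j) (axEc (toSite (R.s (j + 1))) (Lc ^ (j + 1)))) : A' = ANs R Ψs j :=
  (relInv_unique (spr_ANs R Ψs hΨ j) hA' h𝕄 (spr_axEc _ _) hrowsS hrows').symm

/-- [folklore] **AN2-89c's BY-NAME SHADOW**: the RECORD chart `AN R j` (K-U3d's ROOTED corrector) satisfies the (0.4) row ONLY IF it IS the L-chart — so if SYM2 shows `AN ctr 1` failing
`hrowsS`'s numeric twin, (II)'s located seam is exactly «`AN ≠ ANs`», by name and by value. -/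
theorem AN_eq_ANs_of_relInv_rows (j : ℕ) (hΨ : ∀ m, Spr (Ψs m)) (h𝕄 : Spr (𝕄s j))
    (hrowsS : RelInv (ANs R Ψs j) (𝕄s j) (axEc (toSite (R.s (j + 1))) (Lc ^ (j + 1))))
    (hrowsAN : RelInv (AN R j) (𝕄s j) (axEc (toSite (R.s (j + 1))) (Lc ^ (j + 1)))) : AN R j = ANs R Ψs j :=
  eq_ANs_of_relInv_rows R Ψs 𝕄s j hΨ h𝕄 (by obtain ⟨δ, C, hδ, -, h⟩ := decays_AN R j; exact ⟨C, δ, hδ, h⟩) hrowsS hrowsAN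

end Rows

/-! ## §5 (v1.2, an2 W-5 (9)) K-U3d-sym's (0.4) CONTENT AS ONE NULL-SANDWICH ROW: the four corrector letters + «`E ∘ (𝕄ˢʸᵐ − Φsᵀ∘bhK∘Φs) ∘ E = 0`» ⟹ `hrowsS` (`RelInvNullShift`, tree) -/

section Null

variable {Lc : ℕ} [NeZero Lc] (R : Roots Lc) (Ψs Φs Ds : ℕ → MKer (3 + 1) (Fib 3))

/-- [folklore] **`hrowsS` FROM THE CORRECTOR LETTERS AND ONE NULL ROW** (an2 W-5 (9): «K-U3d-sym's (0.4) content is exactly ONE displayed row per storey — the (Dnull) shape of `DshAn1` one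
storey up»).  With the (0.4)-bordered composite Hessian WRITTEN as `Φsᵀ∘bhK (Lc^(j+1))∘Φs + Ds j` (K-U3d's congruence border plus a DISPLAYED difference `Ds j`), IF the corrector letters of
§0 hold and `Ds j` is NULL in the slice sandwich — `axEc ∘ Ds j ∘ axEc = 0` — THEN `RelInv (ANs R Ψs j) (Φsᵀ∘bhK∘Φs + Ds j) (axEc)`: `relInv_ANs` (the owner's socket) + an2's
`RelInvNullShift.relInv_add_of_sandwich_null` (tree).  So L's chart side DISPLAYS `Ψs Φs Ds` + four letters + ONE null row; everything else about the chart is a theorem (§0, §4, here). -/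
theorem relInv_ANs_of_null (j : ℕ) (hΨ : ∀ m, Spr (Ψs m)) (hΦ : Spr (Φs (j + 1))) (hD : Spr (Ds j))
    (hΨΦ : comp (Ψs (j + 1)) (Φs (j + 1)) = idK) (hΦΨ : comp (Φs (j + 1)) (Ψs (j + 1)) = idK)
    (hEΨ : comp (comp (axEc (toSite (R.s (j + 1))) (Lc ^ (j + 1))) (Ψs (j + 1))) (axEc (toSite (R.s (j + 1))) (Lc ^ (j + 1)))
      = comp (Ψs (j + 1)) (axEc (toSite (R.s (j + 1))) (Lc ^ (j + 1))))
    (hEΦ : comp (comp (axEc (toSite (R.s (j + 1))) (Lc ^ (j + 1))) (Φs (j + 1))) (axEc (toSite (R.s (j + 1))) (Lc ^ (j + 1)))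
      = comp (Φs (j + 1)) (axEc (toSite (R.s (j + 1))) (Lc ^ (j + 1))))
    (hnull : comp (comp (axEc (toSite (R.s (j + 1))) (Lc ^ (j + 1))) (Ds j)) (axEc (toSite (R.s (j + 1))) (Lc ^ (j + 1))) = 0) :
    RelInv (ANs R Ψs j) (comp (comp (trK (Φs (j + 1))) (bhK (Lc ^ (j + 1)))) (Φs (j + 1)) + Ds j) (axEc (toSite (R.s (j + 1))) (Lc ^ (j + 1))) :=
  relInv_add_of_sandwich_null (spr_ANs R Ψs hΨ j) (spr_comp (spr_comp (hΦ.trK) (spr_bhK (one_le_of_neZero (Lc ^ (j + 1))))) hΦ)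
    (spr_axEc _ _) hD (relInv_ANs R Ψs Φs j (hΨ (j + 1)) hΦ hΨΦ hΦΨ hEΨ hEΦ) hnull

/-- [folklore] **…AND THEN THE CHART IS PINNED** (§4 ∘ §5): any spread `A′` that is a relative inverse of the SAME displayed (0.4)-bordered Hessian `Φsᵀ∘bhK∘Φs + Ds j` on the slice IS
`ANs R Ψs j` — the object SYM2 solves for directly. -/
theorem eq_ANs_of_null_of_relInv (j : ℕ) (hΨ : ∀ m, Spr (Ψs m)) (hΦ : Spr (Φs (j + 1))) (hD : Spr (Ds j))
    (hΨΦ : comp (Ψs (j + 1)) (Φs (j + 1)) = idK) (hΦΨ : comp (Φs (j + 1)) (Ψs (j + 1)) = idK)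
    (hEΨ : comp (comp (axEc (toSite (R.s (j + 1))) (Lc ^ (j + 1))) (Ψs (j + 1))) (axEc (toSite (R.s (j + 1))) (Lc ^ (j + 1)))
      = comp (Ψs (j + 1)) (axEc (toSite (R.s (j + 1))) (Lc ^ (j + 1))))
    (hEΦ : comp (comp (axEc (toSite (R.s (j + 1))) (Lc ^ (j + 1))) (Φs (j + 1))) (axEc (toSite (R.s (j + 1))) (Lc ^ (j + 1)))
      = comp (Φs (j + 1)) (axEc (toSite (R.s (j + 1))) (Lc ^ (j + 1))))
    (hnull : comp (comp (axEc (toSite (R.s (j + 1))) (Lc ^ (j + 1))) (Ds j)) (axEc (toSite (R.s (j + 1))) (Lc ^ (j + 1))) = 0)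
    {A' : MKer (3 + 1) (Fib 3)} (hA' : Spr A')
    (hrows' : RelInv A' (comp (comp (trK (Φs (j + 1))) (bhK (Lc ^ (j + 1)))) (Φs (j + 1)) + Ds j) (axEc (toSite (R.s (j + 1))) (Lc ^ (j + 1)))) :
    A' = ANs R Ψs j :=
  (relInv_unique (spr_ANs R Ψs hΨ j) hA'
      (spr_add (spr_comp (spr_comp (hΦ.trK) (spr_bhK (one_le_of_neZero (Lc ^ (j + 1))))) hΦ) hD) (spr_axEc _ _)
      (relInv_ANs_of_null R Ψs Φs Ds j hΨ hΦ hD hΨΦ hΦΨ hEΨ hEΦ hnull) hrows').symm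

end Null

/-! ## §6 (v1.3) THE (0.4) COMPOSITE DRESSING FUNCTOR `pullJˢ` OVER A DISPLAYED CORRECTOR — `hN` DISCHARGED modulo three corrector-kernel letters (decay at every rate, a slot transport, the slot adjunction) -/

section PullS

variable {d : ℕ} (P : MKer (d + 1) (Fib d)) (cP : ℝ → ℝ) (hP : ∀ δ : ℝ, 0 ≤ δ → Decays P (cP δ) δ) (hcP : ∀ δ : ℝ, 0 ≤ δ → 0 ≤ cP δ)
  (slot : (Fin (d + 1) → Site (d + 1) → MKer (d + 1) (Fib d)) → (Fin (d + 1) → Site (d + 1) → MKer (d + 1) (Fib d))) (cslot : ℝ → ℝ → ℝ)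
  (hslot : ∀ (S : Fin (d + 1) → Site (d + 1) → MKer (d + 1) (Fib d)) (Cs δ : ℝ), LocStencil S Cs δ → 0 < δ → LocStencil (slot S) (cslot Cs δ) (δ / 2))

/-- [our object — bookkeeping] **THE CORRECTOR-GENERIC DRESSING FUNCTOR ON JET DATA** — `CompositeCorrectorDress.dressPsiAt` with K-U3d's `psiK` replaced by a DISPLAYED spread corrector `P`
that decays at EVERY rate (`hP`, as `decays_psiK` does for the finite-range `Ψ̂_m`) and a DISPLAYED slot transport `slot` preserving local stencils at half rate (`hslot`, as F1's
`slotPsiF`∕`locStencil_slotPsiF`): stencils slot-transported then leg-sandwiched `Pᵀ∘·∘P`, second-order tables leg-sandwiched; rate `δ∕8`, constants by `cSand`. -/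
def dressCorrAt {N : ℕ} (J : JetData d N) : JetData d N where
  S := sandS P (slot J.S)
  W := sandW P J.W
  Cs := cSand d (cP (J.δ / 2)) (cslot J.Cs J.δ) (J.δ / 2)
  Cw := cSand d (cP (J.δ / 2)) J.Cw (J.δ / 2)
  δ := J.δ / 8
  δ_pos := by have := J.δ_pos; positivity
  loc := by
    have h2 := locStencil_sandS (hP (J.δ / 2) (half_pos J.δ_pos).le) (hcP _ (half_pos J.δ_pos).le) (hslot J.S J.Cs J.δ J.loc J.δ_pos) (half_pos J.δ_pos)
    rw [show J.δ / 2 / 4 = J.δ / 8 by ring] at h2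
    exact h2
  loc₂ := by
    have hCw : 0 ≤ J.Cw := (J.loc₂ 0 0 0 0).nonneg (Sum.inl 0)
    have hW' : VertexFamily₂ J.W N J.Cw (J.δ / 2) := fun μ y ν y' => biLoc_mono (J.loc₂ μ y ν y') hCw (by linarith [J.δ_pos])
    have h := vertexFamily₂_sandW (hP (J.δ / 2) (half_pos J.δ_pos).le) (hcP _ (half_pos J.δ_pos).le) hW' (half_pos J.δ_pos)
    rw [show J.δ / 2 / 4 = J.δ / 8 by ring] at h
    exact h

/-- [folklore] the dressed stencil family (`rfl`). -/
theorem dressCorrAt_S {N : ℕ} (J : JetData d N) : (dressCorrAt P cP hP hcP slot cslot hslot J).S = sandS P (slot J.S) := rfl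

/-- [folklore] the dressed second-order family (`rfl`). -/
theorem dressCorrAt_W {N : ℕ} (J : JetData d N) : (dressCorrAt P cP hP hcP slot cslot hslot J).W = sandW P J.W := rfl

/-- [folklore] **THE DRESSING LEMMA OVER AN ARBITRARY SPREAD KERNEL `K`, MODULO THE SLOT ADJUNCTION** (`CompositeCorrectorDress.hessKer_sand_of_adj`, the owner's
corrector-GENERIC identity): `hessKer K (vertexOfK K N (dressCorrAt J).S) (dressCorrAt J).W = hessKer (P∘K∘Pᵀ) (vertexOfK (P∘K∘Pᵀ) N J.S) J.W` whenever
`hadj : ∀ μ y, vertexOfK (P∘K∘Pᵀ) N J.S μ y = vertexOfK K N (slot J.S) μ y` (F1's `vertexOfK_conj_psiK` is this letter for `psiK`). -/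
theorem hessKer_dressCorrAt (hPs : Spr P) {N : ℕ} {K : MKer (d + 1) (Fib d)} (hK : Spr K) (J : JetData d N)
    (hadj : ∀ μ y, vertexOfK (comp (comp P K) (trK P)) N J.S μ y = vertexOfK K N (slot J.S) μ y) (μ ν : Fin (d + 1)) (z : Site (d + 1)) :
    hessKer K (vertexOfK K N (dressCorrAt P cP hP hcP slot cslot hslot J).S) (dressCorrAt P cP hP hcP slot cslot hslot J).W μ ν z
      = hessKer (comp (comp P K) (trK P)) (vertexOfK (comp (comp P K) (trK P)) N J.S) J.W μ ν z := by
  have lW : ∀ μ' y' ν' y'', Loc (J.W μ' y' ν' y'') := fun μ' y' ν' y'' => ⟨_, _, J.Cw, J.δ, J.δ_pos, J.loc₂ μ' y' ν' y''⟩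
  exact (hessKer_sand_of_adj hPs hK (hslot J.S J.Cs J.δ J.loc J.δ_pos) (half_pos J.δ_pos) hadj lW μ ν z).symm

/-- [our object — bookkeeping] **`pullJˢ`** — the block-mean dressing after the corrector dressing (F6e's `pullJ` with `psiK ↦ P`). -/
def pullJs {N : ℕ} [NeZero N] {s : Fin (d + 1) → ℕ} (hs : s ∈ box (d + 1) N) (J : JetData d N) : JetData d N :=
  dressBmAt hs (dressCorrAt P cP hP hcP slot cslot hslot J)

/-- [folklore] **THE TYPED ONE-SHOT KERNEL OF THE `P`-PULLED-BACK DATUM IS THE ONE-LOOP KERNEL ON THE CHART `P ∘ coDressKBmAt (toSite s) N KInv ∘ Pᵀ`** — F6e's `TOf_pullJ`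
with the corrector DISPLAYED; the one letter is the slot adjunction at `K := coDressKBmAt (toSite s) N KInv`. -/
theorem TOf_pullJs (hPs : Spr P) {N : ℕ} [NeZero N] {s : Fin (d + 1) → ℕ} (hs : s ∈ box (d + 1) N) (J : JetData d N)
    (hadj : ∀ μ y, vertexOfK (comp (comp P (coDressKBmAt (toSite s) N (KInv (N := N) (d := d)))) (trK P)) N J.S μ y
      = vertexOfK (coDressKBmAt (toSite s) N (KInv (N := N) (d := d))) N (slot J.S) μ y) :
    TOf (N := N) (pullJs P cP hP hcP slot cslot hslot hs J)
      = hessKer (comp (comp P (coDressKBmAt (toSite s) N (KInv (N := N) (d := d)))) (trK P))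
          (vertexOfK (comp (comp P (coDressKBmAt (toSite s) N (KInv (N := N) (d := d)))) (trK P)) N J.S) J.W := by
  funext μ ν z
  have hN : 1 ≤ N := one_le_of_neZero N
  have eV : vertexOf (N := N) (pullJs P cP hP hcP slot cslot hslot hs J).S
      = vertexOfK (KInv (N := N) (d := d)) N (pullJs P cP hP hcP slot cslot hslot hs J).S :=
    funext fun μ' => funext fun y' => (vertexOfK_KInv (N := N) _ μ' y').symm
  unfold TOf
  rw [eV]
  show hessKer (KInv (N := N) (d := d)) (vertexOfK (KInv (N := N) (d := d)) N (dressBmAt hs (dressCorrAt P cP hP hcP slot cslot hslot J)).S)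
      (dressBmAt hs (dressCorrAt P cP hP hcP slot cslot hslot J)).W μ ν z = _
  rw [hessKer_dressBmAt hs (decays_KInv (N := N) (d := d)) (dressCorrAt P cP hP hcP slot cslot hslot J)]
  exact hessKer_dressCorrAt P cP hP hcP slot cslot hslot hPs (spr_coDressKBmAt hN hs (spr_KInv (N := N) (d := d))) J hadj μ ν z

end PullS

/-! ### §6b The L-composite `JcSym` := record anchor at depths 0∕1, `pullJˢ` of the raw jets at depth `m+2` — and `hN` AS A THEOREM modulo the adjunction letters -/

section JcSym

variable {Lc : ℕ} [NeZero Lc] (hLc : Odd Lc) (N : ℕ) (cΛ cB : ℝ) (R : Roots Lc) (Ψs : ℕ → MKer (3 + 1) (Fib 3))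
  (cΨ : ℕ → ℝ → ℝ) (hΨd : ∀ (m : ℕ) (δ : ℝ), 0 ≤ δ → Decays (Ψs m) (cΨ m δ) δ) (hcΨ : ∀ (m : ℕ) (δ : ℝ), 0 ≤ δ → 0 ≤ cΨ m δ)
  (slotΨ : ℕ → (Fin (3 + 1) → Site (3 + 1) → MKer (3 + 1) (Fib 3)) → (Fin (3 + 1) → Site (3 + 1) → MKer (3 + 1) (Fib 3))) (cslotΨ : ℕ → ℝ → ℝ → ℝ)
  (hslotΨ : ∀ (m : ℕ) (S : Fin (3 + 1) → Site (3 + 1) → MKer (3 + 1) (Fib 3)) (Cs δ : ℝ), LocStencil S Cs δ → 0 < δ → LocStencil (slotΨ m S) (cslotΨ m Cs δ) (δ / 2))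
  (JN : ∀ m : ℕ, JetData 3 (Lc ^ m))

/-- [our object — bookkeeping] **THE COMPOSITE ONE-SHOT JET DATA UNDER L**: depths 0, 1 = ROOT M‴'s one-shot literal `JcOf` (the RECORD's anchor, CORRECT under L); depth `m+2` =
`pullJˢ` of the raw composite jets `JN (m+2)` by the displayed corrector `Ψs (m+2)` at the big root `R.s (m+2)`. -/
def JcSym : ∀ m : ℕ, JetData 3 (Lc ^ m)
  | 0 => JcOf hLc N (fun _ => cΛ) (fun _ => cB) 0
  | 1 => JcOf hLc N (fun _ => cΛ) (fun _ => cB) 1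
  | (m + 2) => pullJs (Ψs (m + 2)) (cΨ (m + 2)) (hΨd (m + 2)) (hcΨ (m + 2)) (slotΨ (m + 2)) (cslotΨ (m + 2)) (hslotΨ (m + 2)) (R.hs (m + 2)) (JN (m + 2))

/-- [folklore] `hJc1` for `JcSym` (`rfl`). -/
theorem JcSym_one : JcSym hLc N cΛ cB R Ψs cΨ hΨd hcΨ slotΨ cslotΨ hslotΨ JN 1 = JcOf hLc N (fun _ => cΛ) (fun _ => cB) 1 := rfl

/-- [folklore] **(L2′) `hN` UNDER L AS A THEOREM modulo the adjunction letters**: for every storey `j ≥ 1`,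
`hessKer (ANs R Ψs j) (VNsOf R Ψs JN j) (JN (j+1)).W = TshotOf Lc JcSym (j+1)` — `TOf_pullJs` at `K := coDressKBmAt (toSite (R.s (j+1))) (Lc^(j+1)) KInv`. -/
theorem hN_JcSym (hΨs : ∀ m, Spr (Ψs m))
    (hadj : ∀ (m : ℕ) (μ : Fin (3 + 1)) (y : Site (3 + 1)),
      vertexOfK (ANs R Ψs (m + 1)) (Lc ^ (m + 2)) (JN (m + 2)).S μ y
        = vertexOfK (coDressKBmAt (toSite (R.s (m + 2))) (Lc ^ (m + 2)) (KInv (N := Lc ^ (m + 2)) (d := 3))) (Lc ^ (m + 2)) (slotΨ (m + 2) (JN (m + 2)).S) μ y) :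
    ∀ j : ℕ, 1 ≤ j → ∀ (a b : Fin 4) (z : Fin 4 → ℤ),
      hessKer (ANs R Ψs j) (VNsOf R Ψs JN j) (JN (j + 1)).W a b z = TshotOf Lc (JcSym hLc N cΛ cB R Ψs cΨ hΨd hcΨ slotΨ cslotΨ hslotΨ JN) (j + 1) a b z := by
  intro j hj a b z
  obtain ⟨m, rfl⟩ : ∃ m : ℕ, j = m + 1 := ⟨j - 1, (Nat.sub_add_cancel hj).symm⟩
  have h := TOf_pullJs (Ψs (m + 2)) (cΨ (m + 2)) (hΨd (m + 2)) (hcΨ (m + 2)) (slotΨ (m + 2)) (cslotΨ (m + 2)) (hslotΨ (m + 2))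
    (hΨs (m + 2)) (R.hs (m + 2)) (JN (m + 2)) (hadj m)
  show hessKer (ANs R Ψs (m + 1)) (VNsOf R Ψs JN (m + 1)) (JN (m + 1 + 1)).W a b z
    = TOf (N := Lc ^ (m + 1 + 1)) (JcSym hLc N cΛ cB R Ψs cΨ hΨd hcΨ slotΨ cslotΨ hslotΨ JN (m + 1 + 1)) a b z
  rw [show JcSym hLc N cΛ cB R Ψs cΨ hΨd hcΨ slotΨ cslotΨ hslotΨ JN (m + 1 + 1)
      = pullJs (Ψs (m + 2)) (cΨ (m + 2)) (hΨd (m + 2)) (hcΨ (m + 2)) (slotΨ (m + 2)) (cslotΨ (m + 2)) (hslotΨ (m + 2)) (R.hs (m + 2)) (JN (m + 2)) from rfl, h]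
  rfl

/-- [folklore] **THE L-END WITH `hN` DISCHARGED**: at ROOT M‴'s literal and the L-composite `JcSym`, `D1Tel` ⟸ `hlawL` ∧ the corrector-kernel letters (`Spr`, decay family, slot transport
locality — in `JcSym`'s parameters — and the slot ADJUNCTION `hadj`) ∧ the record's `hT0 hT1`.  (`d1Tel_sym_record_of_hlawL` ∘ `hN_JcSym`.)  `hlawL` DISPLAY RULE (R-D1-g93-1 (R4)): (i) OPEN by name — the [K-step] law itself is the crux; (ii) ✓ by value OF RECORD at ONE lattice (2,3), float64 (S2 factored 1.46e−12, D₁⁺ 1.86e−12; `SPAN-SYM2.addendum4.md` 56c550e9, RULING SYM2-10; informational, zero weight); (iii) cite [B12] CMP 109 (1987) p. 264 (1.20)–(1.22), printed context only (ABSOLUTE RULE). -/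
theorem d1Tel_sym_record_JcSym_of_hlawL (hΨs : ∀ m, Spr (Ψs m))
    (hadj : ∀ (m : ℕ) (μ : Fin (3 + 1)) (y : Site (3 + 1)),
      vertexOfK (ANs R Ψs (m + 1)) (Lc ^ (m + 2)) (JN (m + 2)).S μ y
        = vertexOfK (coDressKBmAt (toSite (R.s (m + 2))) (Lc ^ (m + 2)) (KInv (N := Lc ^ (m + 2)) (d := 3))) (Lc ^ (m + 2)) (slotΨ (m + 2) (JN (m + 2)).S) μ y)
    (hlawL : ∀ j : ℕ, 1 ≤ j → ∀ (a b : Fin 4) (z : Fin 4 → ℤ),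
      hessKer (ANs R Ψs j) (VNsOf R Ψs JN j) (JN (j + 1)).W a b z =
        (Lc : ℝ) ^ 8 * dressedEntry (wStep Lc j) (TshotOf Lc (JcSym hLc N cΛ cB R Ψs cΨ hΨd hcΨ slotΨ cslotΨ hslotΨ JN) j) ((Lc : ℤ) • z) a b
          + TbalOf Lc (JsB12CombShSym hLc N (symTablesAn1S2 3 Lc cΛ) cΛ cB) j a b z)
    (hT0 : ∀ j (c e : Fin 4), HasSum (TbalOf Lc (JsB12CombShSym hLc N (symTablesAn1S2 3 Lc cΛ) cΛ cB) j c e) 0)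
    (hT1 : ∀ j (c e ρ : Fin 4), HasSum (fun t : Fin 4 → ℤ => t ρ • TbalOf Lc (JsB12CombShSym hLc N (symTablesAn1S2 3 Lc cΛ) cΛ cB) j c e t) 0) :
    D1Tel Lc (JsB12CombShSym hLc N (symTablesAn1S2 3 Lc cΛ) cΛ cB) (JcSym hLc N cΛ cB R Ψs cΨ hΨd hcΨ slotΨ cslotΨ hslotΨ JN) :=
  d1Tel_sym_record_of_hlawL hLc N cΛ cB R Ψs JN _ (JcSym_one hLc N cΛ cB R Ψs cΨ hΨd hcΨ slotΨ cslotΨ hslotΨ JN)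
    (hN_JcSym hLc N cΛ cB R Ψs cΨ hΨd hcΨ slotΨ cslotΨ hslotΨ JN hΨs hadj) hlawL hT0 hT1

/-- [folklore] **§7 (v1.4) THE L-END AT THE PINNED RECORD DISPLAYS NO WARD DATUM**: with the record's pin letters `2 ≤ Lc`, `2 ≤ N`, `cΛ·Lc⁴ = 2`, `cB = −Lc¹²∕4`, the (T0)(T1) hypotheses
of `d1Tel_sym_record_JcSym_of_hlawL` are the TREE's `stepT0∕stepT1_JsB12CombShSym_an1S2_pinned` (road g42 `FP/StepKernelWardDataRecord`) — so `D1Tel` at ROOT M‴'s literal and the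
L-composite `JcSym` follows from `hlawL` ∧ the corrector-kernel letters (`hΨs`, the decay family and slot transport in `JcSym`'s parameters, the slot adjunction `hadj`) ALONE.
(XREAD-TT TAIL `…_pinned`, an2 g90 ONLINE (c).)  HONEST: `hlawL` is the content row; `Ψs` displayed; K-U3d-sym not claimed here (its kernel letters are the row's F-L1∕F-L5 theorems, fed by name in S-L3b `FP.StepRecursionSymEnd`).  `hlawL` DISPLAY RULE (R-D1-g93-1 (R4)): (i) OPEN by name — the [K-step] law itself is the crux; (ii) ✓ by value OF RECORD at ONE lattice (2,3), float64 (S2 factored 1.46e−12, D₁⁺ 1.86e−12; `SPAN-SYM2.addendum4.md` 56c550e9, RULING SYM2-10; informational, zero weight); (iii) cite [B12] CMP 109 (1987) p. 264 (1.20)–(1.22), printed context only (ABSOLUTE RULE). -/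
theorem d1Tel_sym_record_JcSym_of_hlawL_pinned (hL2 : 2 ≤ Lc) (hN2 : 2 ≤ N) (hΛ : cΛ * (Lc : ℝ) ^ 4 = 2) (hcB : cB = -((Lc : ℝ) ^ 12 / 4))
    (hΨs : ∀ m, Spr (Ψs m))
    (hadj : ∀ (m : ℕ) (μ : Fin (3 + 1)) (y : Site (3 + 1)),
      vertexOfK (ANs R Ψs (m + 1)) (Lc ^ (m + 2)) (JN (m + 2)).S μ y
        = vertexOfK (coDressKBmAt (toSite (R.s (m + 2))) (Lc ^ (m + 2)) (KInv (N := Lc ^ (m + 2)) (d := 3))) (Lc ^ (m + 2)) (slotΨ (m + 2) (JN (m + 2)).S) μ y)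
    (hlawL : ∀ j : ℕ, 1 ≤ j → ∀ (a b : Fin 4) (z : Fin 4 → ℤ),
      hessKer (ANs R Ψs j) (VNsOf R Ψs JN j) (JN (j + 1)).W a b z =
        (Lc : ℝ) ^ 8 * dressedEntry (wStep Lc j) (TshotOf Lc (JcSym hLc N cΛ cB R Ψs cΨ hΨd hcΨ slotΨ cslotΨ hslotΨ JN) j) ((Lc : ℤ) • z) a b
          + TbalOf Lc (JsB12CombShSym hLc N (symTablesAn1S2 3 Lc cΛ) cΛ cB) j a b z) :
    D1Tel Lc (JsB12CombShSym hLc N (symTablesAn1S2 3 Lc cΛ) cΛ cB) (JcSym hLc N cΛ cB R Ψs cΨ hΨd hcΨ slotΨ cslotΨ hslotΨ JN) :=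
  d1Tel_sym_record_JcSym_of_hlawL hLc N cΛ cB R Ψs cΨ hΨd hcΨ slotΨ cslotΨ hslotΨ JN hΨs hadj hlawL
    (stepT0_JsB12CombShSym_an1S2_pinned hLc hL2 hN2 cΛ cB hΛ hcB) (stepT1_JsB12CombShSym_an1S2_pinned hLc hL2 hN2 cΛ cB hΛ hcB)

end JcSym

end Summit.QuantumFields.BalabanUV.Beta.FP.TowerKernelLawNamedSym

end
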